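import Summits.CriticalPhenomena.PercolationContinuityZ3.Theorems.PercNearOneGluingNoHeavyLowerTailSahiLatinZeros

/-!
# `NoHeavyLowerTail` (crux stmt-CriticalPhenomena-4575), Sahi programme (prim-master-conj gen 43): the LEVEL-RELABELLING SYMMETRY of the Latin kernel
# and the Lieb–Sahi AVERAGING IDENTITY `2κ(a,b,c) = κ(a ∪ τa, b, c) + κ(a ∩ τa, b, c)` in every dimension (with its rigidity at zeros under FBP)

Support file (`--supports stmt-CriticalPhenomena-4575`; companion of `…SahiLatinKernel/Moves/Descent/Zeros`; memo
`run/shared/lean/prim/prim-l12/FROM-prim-master-conj-g43-ZERO-LOCUS.md` §1).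

THE MATHEMATICS (all `d`; everything PROVED, axioms standard).
* `relabelPt i σ : Pt ι ≃ Pt ι` — apply the permutation `σ ∈ S₃` to the `i`-th coordinate; `relabel i σ s` — its action on subsets of `[3]^ι`.
* **`kappa_relabel`**: `κ(σa, σb, σc) = κ(a,b,c)` — the uniform measure on Latin triples is invariant under relabelling the three levels of one axis
  (reindex the Latin sum `ρ ↦ (i ↦ σ ∘ ρ i)`); hence `kappa_relabel_left`: if `b, c` are `σ`-INVARIANT then `κ(σa,b,c) = κ(a,b,c)`.
* `kappa_union_add_kappa_inter`: `κ(a ∪ a', b, c) + κ(a ∩ a', b, c) = κ(a,b,c) + κ(a',b,c)` (modularity of the first-point form); hence the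
  **LIEB–SAHI AVERAGING IDENTITY** `two_mul_kappa_eq` — for `σ`-invariant `b, c`: `2κ(a,b,c) = κ(a ∪ σa, b, c) + κ(a ∩ σa, b, c)` — the polarised,
  every-dimension form of [LiebSahi2021, Prop. 3.10] (`2E_n(…,a) = E_n(…,a⁺) + E_n(…,a⁻)`); for the transposition of two ADJACENT levels the two new
  sets are again up-sets (`isUpperSet_union_relabel_swap`, `isUpperSet_inter_relabel_swap`).
* RIGIDITY AT ZEROS (`kappa_union_inter_eq_zero_of_zero`): under FBP (`LatinPos ι`), if `κ(a,b,c) = 0` and `b, c` do not distinguish two adjacent levels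
  of an axis, then `a ∪ τa` and `a ∩ τa` are zeros too.
USE: (i) a minimal counterexample to FBP of maximal size has every adjacent level pair on every axis distinguished by 0 or ≥ 2 of the three sets (the LS22
extremal argument in the width direction; memo §1 records that in `d = 3` this leaves 26 classes of extremal triples, so it does not close an induction by
itself); (ii) a further cost-free move inside the zero locus (memo §2). [this work]
-/

namespace Summit.CriticalPhenomena.PercolationContinuityZ3.Theorems.SahiLatin

open Finset

variable {ι : Type*} [Fintype ι] [DecidableEq ι]

/-! ## Relabelling the levels of one axis -/

/-- Apply `σ ∈ S₃` to the `i`-th coordinate (a permutation of the grid `[3]^ι`). [this work] -/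
def relabelPt (i : ι) (σ : Equiv.Perm (Fin 3)) : Pt ι ≃ Pt ι where
  toFun x := Function.update x i (σ (x i))
  invFun x := Function.update x i (σ.symm (x i))
  left_inv x := by
    funext j
    by_cases hji : j = i
    · subst hji; simp
    · simp [Function.update_of_ne hji]
  right_inv x := by
    funext j
    by_cases hji : j = i
    · subst hji; simp
    · simp [Function.update_of_ne hji]

omit [Fintype ι] in
/-- The relabelled point at the axis `i`. [this work] -/
@[simp] theorem relabelPt_apply_self (i : ι) (σ : Equiv.Perm (Fin 3)) (x : Pt ι) : relabelPt i σ x i = σ (x i) := by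
  simp [relabelPt]

omit [Fintype ι] in
/-- The relabelled point off the axis `i`. [this work] -/
theorem relabelPt_apply_of_ne (i : ι) (σ : Equiv.Perm (Fin 3)) (x : Pt ι) {j : ι} (hj : j ≠ i) : relabelPt i σ x j = x j := by
  simp [relabelPt, Function.update_of_ne hj]

/-- The action on subsets of the grid. [this work] -/
def relabel (i : ι) (σ : Equiv.Perm (Fin 3)) (s : Finset (Pt ι)) : Finset (Pt ι) := s.map (relabelPt i σ).toEmbedding

omit [Fintype ι] in
/-- Membership in a relabelled set. [this work] -/
theorem mem_relabel {i : ι} {σ : Equiv.Perm (Fin 3)} {s : Finset (Pt ι)} {x : Pt ι} :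
    x ∈ relabel i σ s ↔ (relabelPt i σ).symm x ∈ s := by
  rw [relabel, mem_map_equiv]

omit [Fintype ι] in
/-- A relabelled point lies in the relabelled set iff the point lies in the set. [this work] -/
theorem relabelPt_mem_relabel {i : ι} {σ : Equiv.Perm (Fin 3)} {s : Finset (Pt ι)} {x : Pt ι} :
    relabelPt i σ x ∈ relabel i σ s ↔ x ∈ s := by
  rw [mem_relabel, Equiv.symm_apply_apply]

/-- Indicators transform accordingly. [this work] -/
theorem ind_relabel (i : ι) (σ : Equiv.Perm (Fin 3)) (s : Finset (Pt ι)) (x : Pt ι) :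
    ind (relabel i σ s) (relabelPt i σ x) = ind s x := by
  by_cases hx : x ∈ s
  · rw [ind_of_mem hx, ind_of_mem (relabelPt_mem_relabel.2 hx)]
  · rw [ind_of_not_mem hx, ind_of_not_mem (fun h => hx (relabelPt_mem_relabel.1 h))]

/-! ## The induced permutation of Latin triples -/

/-- The induced permutation of Latin triples: compose the `i`-th local permutation with `σ`. [this work] -/
def relabelLPerm (i : ι) (σ : Equiv.Perm (Fin 3)) : LPerm ι ≃ LPerm ι where
  toFun ρ := Function.update ρ i (σ * ρ i)
  invFun ρ := Function.update ρ i (σ⁻¹ * ρ i)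
  left_inv ρ := by
    funext j
    by_cases hji : j = i
    · subst hji; simp [← mul_assoc]
    · simp [Function.update_of_ne hji]
  right_inv ρ := by
    funext j
    by_cases hji : j = i
    · subst hji; simp [← mul_assoc]
    · simp [Function.update_of_ne hji]

omit [Fintype ι] in
/-- The points of the relabelled Latin triple are the relabelled points. [this work] -/
theorem lpt_relabelLPerm (i : ι) (σ : Equiv.Perm (Fin 3)) (ρ : LPerm ι) (j : Fin 3) :
    lpt (relabelLPerm i σ ρ) j = relabelPt i σ (lpt ρ j) := by
  funext k
  by_cases hki : k = i
  · subst hki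
    simp [lpt, relabelLPerm, relabelPt, Equiv.Perm.mul_apply]
  · simp [lpt, relabelLPerm, relabelPt, Function.update_of_ne hki]

/-! ## Adjacent transpositions keep up-sets -/

/-- Adjacent levels `(l, l') ∈ {(0,1), (1,2)}` of `Fin 3`. [this work] -/
def Adjacent (l l' : Fin 3) : Prop := (l = 0 ∧ l' = 1) ∨ (l = 1 ∧ l' = 2)

/-- For adjacent `l < l'`: `l ≤ l'`; every level `≥ l` other than `l` is `≥ l'`; every level `≤ l'` other than `l'` is `≤ l` (finite checks).
[this work] -/
theorem Adjacent.cases_le {l l' : Fin 3} (h : Adjacent l l') :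
    l ≤ l' ∧ (∀ v : Fin 3, l ≤ v → v ≠ l → l' ≤ v) ∧ (∀ v : Fin 3, v ≤ l' → v ≠ l' → v ≤ l) := by
  rcases h with ⟨rfl, rfl⟩ | ⟨rfl, rfl⟩ <;> decide

omit [Fintype ι] in
/-- The transposition of two levels, applied at axis `i`, moves a point only if its `i`-th coordinate is one of the two levels. [this work] -/
theorem relabelPt_swap_eq_self {i : ι} {l l' : Fin 3} {x : Pt ι} (h1 : x i ≠ l) (h2 : x i ≠ l') :
    relabelPt i (Equiv.swap l l') x = x := by
  funext j
  by_cases hji : j = i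
  · subst hji; rw [relabelPt_apply_self, Equiv.swap_apply_of_ne_of_ne h1 h2]
  · exact relabelPt_apply_of_ne i _ x hji

omit [Fintype ι] in
/-- If `x i = l ≤ l'` then `x ≤ τx`. [this work] -/
theorem le_relabelPt_swap {i : ι} {l l' : Fin 3} (hll : l ≤ l') {x : Pt ι} (hx : x i = l) : x ≤ relabelPt i (Equiv.swap l l') x := by
  intro j
  by_cases hji : j = i
  · subst hji; rw [relabelPt_apply_self, hx, Equiv.swap_apply_left]; exact hll
  · rw [relabelPt_apply_of_ne i _ x hji]

omit [Fintype ι] in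
/-- If `x i = l'` with `l ≤ l'` then `τx ≤ x`. [this work] -/
theorem relabelPt_swap_le {i : ι} {l l' : Fin 3} (hll : l ≤ l') {x : Pt ι} (hx : x i = l') : relabelPt i (Equiv.swap l l') x ≤ x := by
  intro j
  by_cases hji : j = i
  · subst hji; rw [relabelPt_apply_self, hx, Equiv.swap_apply_right]; exact hll
  · rw [relabelPt_apply_of_ne i _ x hji]

omit [Fintype ι] in
/-- The transposition is an involution on points. [this work] -/
theorem relabelPt_swap_swap (i : ι) (l l' : Fin 3) (x : Pt ι) :
    relabelPt i (Equiv.swap l l') (relabelPt i (Equiv.swap l l') x) = x := by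
  funext j
  by_cases hji : j = i
  · subst hji; simp [relabelPt]
  · simp [relabelPt, Function.update_of_ne hji]

omit [Fintype ι] in
/-- Membership in the image under a transposition: `x ∈ τs ↔ τx ∈ s`. [this work] -/
theorem mem_relabel_swap {i : ι} {l l' : Fin 3} {s : Finset (Pt ι)} {x : Pt ι} :
    x ∈ relabel i (Equiv.swap l l') s ↔ relabelPt i (Equiv.swap l l') x ∈ s := by
  rw [mem_relabel]
  have : (relabelPt i (Equiv.swap l l')).symm x = relabelPt i (Equiv.swap l l') x := by
    rw [Equiv.symm_apply_eq, relabelPt_swap_swap]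
  rw [this]

/-- **For the transposition of two ADJACENT levels, `a ∪ τa` is an up-set whenever `a` is.** [this work] -/
theorem isUpperSet_union_relabel_swap {a : Finset (Pt ι)} (ha : IsUpperSet (a : Set (Pt ι))) (i : ι) {l l' : Fin 3}
    (hadj : Adjacent l l') : IsUpperSet ((a ∪ relabel i (Equiv.swap l l') a : Finset (Pt ι)) : Set (Pt ι)) := by
  obtain ⟨hll, hup, -⟩ := hadj.cases_le
  intro x y hxy hx
  rw [Finset.mem_coe, mem_union, mem_relabel_swap] at hx ⊢
  rcases hx with hx | hx
  · exact Or.inl (ha hxy hx)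
  · by_cases hxi : x i = l
    · by_cases hyi : y i = l
      · right
        refine ha (show relabelPt i (Equiv.swap l l') x ≤ relabelPt i (Equiv.swap l l') y from fun j => ?_) hx
        by_cases hji : j = i
        · subst hji; rw [relabelPt_apply_self, relabelPt_apply_self, hxi, hyi]
        · rw [relabelPt_apply_of_ne i _ x hji, relabelPt_apply_of_ne i _ y hji]; exact hxy j
      · left
        refine ha (show relabelPt i (Equiv.swap l l') x ≤ y from fun j => ?_) hx
        by_cases hji : j = i
        · subst hji
          rw [relabelPt_apply_self, hxi, Equiv.swap_apply_left]
          exact hup (y j) (hxi ▸ hxy j) hyi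
        · rw [relabelPt_apply_of_ne i _ x hji]; exact hxy j
    · by_cases hxi' : x i = l'
      · exact Or.inl (ha hxy (ha (relabelPt_swap_le hll hxi') hx))
      · rw [relabelPt_swap_eq_self hxi hxi'] at hx
        exact Or.inl (ha hxy hx)

/-- **For the transposition of two ADJACENT levels, `a ∩ τa` is an up-set whenever `a` is.** [this work] -/
theorem isUpperSet_inter_relabel_swap {a : Finset (Pt ι)} (ha : IsUpperSet (a : Set (Pt ι))) (i : ι) {l l' : Fin 3}
    (hadj : Adjacent l l') : IsUpperSet ((a ∩ relabel i (Equiv.swap l l') a : Finset (Pt ι)) : Set (Pt ι)) := by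
  obtain ⟨hll, -, hdown⟩ := hadj.cases_le
  intro x y hxy hx
  rw [Finset.mem_coe, mem_inter, mem_relabel_swap] at hx ⊢
  refine ⟨ha hxy hx.1, ?_⟩
  by_cases hyi : y i = l'
  · by_cases hxi : x i = l'
    · refine ha (show relabelPt i (Equiv.swap l l') x ≤ relabelPt i (Equiv.swap l l') y from fun j => ?_) hx.2
      by_cases hji : j = i
      · subst hji; rw [relabelPt_apply_self, relabelPt_apply_self, hxi, hyi]
      · rw [relabelPt_apply_of_ne i _ x hji, relabelPt_apply_of_ne i _ y hji]; exact hxy j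
    · refine ha (show x ≤ relabelPt i (Equiv.swap l l') y from fun j => ?_) hx.1
      by_cases hji : j = i
      · subst hji
        rw [relabelPt_apply_self, hyi, Equiv.swap_apply_right]
        exact hdown (x j) (hyi ▸ hxy j) hxi
      · rw [relabelPt_apply_of_ne i _ y hji]; exact hxy j
  · by_cases hyi' : y i = l
    · exact ha ((show x ≤ y from hxy).trans (le_relabelPt_swap hll hyi')) hx.1
    · rw [relabelPt_swap_eq_self hyi' hyi]
      exact ha hxy hx.1

/-! ## Invariance of the Latin kernel, modularity, the Lieb–Sahi averaging identity -/

/-- **Relabelling symmetry of the Latin kernel** (all `d`): `κ(σa, σb, σc) = κ(a, b, c)` for every axis `i` and every `σ ∈ S₃`. [this work] -/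
theorem kappa_relabel (i : ι) (σ : Equiv.Perm (Fin 3)) (a b c : Finset (Pt ι)) :
    kappa (relabel i σ a) (relabel i σ b) (relabel i σ c) = kappa a b c := by
  unfold kappa
  rw [← (relabelLPerm i σ).sum_comp]
  refine Fintype.sum_congr _ _ fun ρ => ?_
  simp only [lpt_relabelLPerm, G, ind_relabel]

/-- Hence, if `b` and `c` are `σ`-invariant, relabelling `a` alone does not change `κ`. [this work] -/
theorem kappa_relabel_left {i : ι} {σ : Equiv.Perm (Fin 3)} {a b c : Finset (Pt ι)} (hb : relabel i σ b = b) (hc : relabel i σ c = c) :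
    kappa (relabel i σ a) b c = kappa a b c := by
  conv_lhs => rw [← hb, ← hc]
  exact kappa_relabel i σ a b c

/-- **Modularity in the first slot**: `κ(a ∪ a', b, c) + κ(a ∩ a', b, c) = κ(a,b,c) + κ(a',b,c)`. [this work] -/
theorem kappa_union_add_kappa_inter (a a' b c : Finset (Pt ι)) :
    kappa (a ∪ a') b c + kappa (a ∩ a') b c = kappa a b c + kappa a' b c := by
  simp only [kappa_eq_sum_Phi]
  exact sum_union_inter

/-- **LIEB–SAHI AVERAGING IDENTITY** (all `d`): if `b, c` are invariant under the relabelling `σ` of axis `i`, then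
`2κ(a,b,c) = κ(a ∪ σa, b, c) + κ(a ∩ σa, b, c)`. [this work] -/
theorem two_mul_kappa_eq {i : ι} {σ : Equiv.Perm (Fin 3)} {a b c : Finset (Pt ι)} (hb : relabel i σ b = b) (hc : relabel i σ c = c) :
    2 * kappa a b c = kappa (a ∪ relabel i σ a) b c + kappa (a ∩ relabel i σ a) b c := by
  rw [kappa_union_add_kappa_inter, kappa_relabel_left hb hc]; ring

/-! ## Rigidity at zeros under FBP -/

/-- **LS-RIGIDITY AT ZEROS** (all `d`): under FBP, if `κ(a,b,c) = 0` and the up-sets `b, c` are invariant under the transposition of two adjacent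
levels of axis `i`, then `κ(a ∪ τa, b, c) = 0` and `κ(a ∩ τa, b, c) = 0`. [this work] -/
theorem kappa_union_inter_eq_zero_of_zero (hL : LatinPos ι) {a b c : Finset (Pt ι)} (hup : UpTriple a b c) (h0 : kappa a b c = 0)
    (i : ι) {l l' : Fin 3} (hadj : Adjacent l l') (hb : relabel i (Equiv.swap l l') b = b) (hc : relabel i (Equiv.swap l l') c = c) :
    kappa (a ∪ relabel i (Equiv.swap l l') a) b c = 0 ∧ kappa (a ∩ relabel i (Equiv.swap l l') a) b c = 0 := by
  have h2 := two_mul_kappa_eq (a := a) hb hc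
  rw [h0, mul_zero] at h2
  have hu : 0 ≤ kappa (a ∪ relabel i (Equiv.swap l l') a) b c :=
    hL _ _ _ ⟨isUpperSet_union_relabel_swap hup.1 i hadj, hup.2.1, hup.2.2⟩
  have hi : 0 ≤ kappa (a ∩ relabel i (Equiv.swap l l') a) b c :=
    hL _ _ _ ⟨isUpperSet_inter_relabel_swap hup.1 i hadj, hup.2.1, hup.2.2⟩
  constructor <;> linarith

end Summit.CriticalPhenomena.PercolationContinuityZ3.Theorems.SahiLatin
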